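import Summits.KontsevichZagierPeriods.KontsevichZagierPeriods.Theses.WeightFloor
import Summits.KontsevichZagierPeriods.KontsevichZagierPeriods.Theorems.InverseLandauTateLiftingSolidGeometry
import Summits.KontsevichZagierPeriods.KontsevichZagierPeriods.Theorems.InverseLandauTateLiftingAffineChart
import Summits.KontsevichZagierPeriods.KontsevichZagierPeriods.Theorems.HyperbolicBlochOffTetraSectorKernelRedAux

/-!
# `ConicStones` (stmt-KontsevichZagierPeriods-12251, route WeightFloor) — proof

Two *smooth conic stones* — compact regular closed planar sets with non-empty interior whose
frontier lies in the smooth real locus `{p = 0, ∇p ≠ 0}` of a rational `p` of total degree `≤ 2` —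
with equal area are KZ-equivalent. **Classification**: such a stone `D` is a filled rational
ellipse `{P ≤ 0}`, `P` the real function of `p` or `−p`, with positive-definite quadratic part `Q`.
Indeed `P(x + tw) = P x + t ∇P(x)·w + t² Q(w)`; (i) `P ≢ 0` on `U = interior D`, else `∇P = 0` on
`U` (difference quotients) and on `closure U = D ⊇ frontier D ≠ ∅`, contradicting smoothness;
(ii) if `P x ≠ 0` at `x ∈ U` and `Q w` has the sign of `P x` (or vanishes) for some `w ≠ 0`, orient
`w` so that `∇P(x)·w` has that sign too: then `|P| ≥ |P x| > 0` on the ray `x + ℝ₊w`, a connected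
set missing `frontier D ⊆ {P = 0}` and meeting `U`, hence inside the bounded `D` — absurd; so, up
to sign, `P ≤ 0` on `U`, `P x₀ < 0` somewhere, `Q` is positive definite; (iii) `D = closure U ⊆
{P ≤ 0}`, and the convex set `{P < 0}` misses the frontier and meets `U`, so lies in `U`, and its
closure contains `{P ≤ 0}`. **Presentation**: completing squares, `{P ≤ 0} = A·B̄ + c₀` (`B̄` the
closed unit disc, `c₀` the rational centre, `A` upper triangular with entries rationals times
square roots of positive rationals, `det A ≠ 0`); conclude by the landed ellipsoid sector
`InverseLandau.kzPeriodConjecture_ellipsoid`. References: Kontsevich–Zagier, *Periods* (2001),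
§1.2; Bochnak–Coste–Roy, *Real Algebraic Geometry* (1998), §2.
-/

noncomputable section

namespace Summit.KontsevichZagierPeriods.WeightFloor

open Set Filter Topology MvPolynomial
open Literature.NumberTheory.Transcendental HyperbolicBloch.OffTetraSectorKernel

/-- Normal form of a rational polynomial of total degree `≤ 2` in two variables (the sum of its six
monomials of degree `≤ 2`) and of its two partial derivatives, as real functions. [folklore] -/
theorem exists_coeffs (p : MvPolynomial (Fin 2) ℚ) (hp : p.totalDegree ≤ 2) :
    ∃ a b c d e f : ℚ, ∀ x : Fin 2 → ℝ,
      MvPolynomial.aeval x p = a * x 0 ^ 2 + b * x 0 * x 1 + c * x 1 ^ 2 + d * x 0 + e * x 1 + f ∧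
      MvPolynomial.aeval x (MvPolynomial.pderiv 0 p) = 2 * a * x 0 + b * x 1 + d ∧
      MvPolynomial.aeval x (MvPolynomial.pderiv 1 p) = b * x 0 + 2 * c * x 1 + e := by
  obtain ⟨a, b, c, d, e, f, rfl⟩ : ∃ a b c d e f : ℚ, p = monomial (Finsupp.single 0 2) a +
      monomial (Finsupp.single 0 1 + Finsupp.single 1 1) b + monomial (Finsupp.single 1 2) c +
      monomial (Finsupp.single 0 1) d + monomial (Finsupp.single 1 1) e + monomial 0 f := by
    refine ⟨p.coeff (Finsupp.single 0 2), p.coeff (Finsupp.single 0 1 + Finsupp.single 1 1),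
      p.coeff (Finsupp.single 1 2), p.coeff (Finsupp.single 0 1), p.coeff (Finsupp.single 1 1),
      p.coeff 0, ?_⟩
    ext m
    obtain ⟨i, j, rfl⟩ : ∃ i j : ℕ, m = Finsupp.single 0 i + Finsupp.single 1 j :=
      ⟨m 0, m 1, by ext k; fin_cases k <;> simp⟩
    have key : ∀ i' j' : ℕ, (Finsupp.single (0 : Fin 2) i' + Finsupp.single 1 j' =
        Finsupp.single 0 i + Finsupp.single 1 j) ↔ (i' = i ∧ j' = j) := fun i' j' => by
      simp [Finsupp.ext_iff, Fin.forall_fin_two]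
    have k20 := key 2 0; have k11 := key 1 1; have k02 := key 0 2
    have k10 := key 1 0; have k01 := key 0 1; have k00 := key 0 0
    simp only [Finsupp.single_zero, add_zero, zero_add] at k20 k11 k02 k10 k01 k00
    simp only [coeff_add, coeff_monomial, k20, k11, k02, k10, k01]
    by_cases hij : i + j ≤ 2
    · have hi : i ≤ 2 := by omega
      have hj : j ≤ 2 := by omega
      interval_cases i <;> interval_cases j <;> simp_all
    · have h0 : p.coeff (Finsupp.single 0 i + Finsupp.single 1 j) = 0 := by
        refine notMem_support_iff.mp fun hm => ?_
        have := le_totalDegree hm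
        simp [Finsupp.sum_add_index', Finsupp.sum_single_index] at this
        omega
      have k0 : ((0 : Fin 2 →₀ ℕ) = Finsupp.single 0 i + Finsupp.single 1 j) ↔ (0 = i ∧ 0 = j) := by
        simpa using k00
      simp only [h0, k0]
      split_ifs <;> simp_all <;> omega
  refine ⟨a, b, c, d, e, f, fun x => ?_⟩
  simp only [map_add, aeval_monomial, pderiv_monomial, Finsupp.prod_pow, Fin.prod_univ_two]
  simp
  exact ⟨by ring, Or.inl (by ring), Or.inl (by ring)⟩

section Real

variable {a b c d e f : ℝ} {P : (Fin 2 → ℝ) → ℝ} {D : Set (Fin 2 → ℝ)}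

/-- Exact second-order Taylor expansion of a quadratic function along a line. [folklore] -/
theorem taylor_two
    (hP : ∀ x, P x = a * x 0 ^ 2 + b * x 0 * x 1 + c * x 1 ^ 2 + d * x 0 + e * x 1 + f)
    (x w : Fin 2 → ℝ) (t : ℝ) :
    P (x + t • w) = P x + t * ((2 * a * x 0 + b * x 1 + d) * w 0 + (b * x 0 + 2 * c * x 1 + e) * w 1)
      + t ^ 2 * (a * w 0 ^ 2 + b * w 0 * w 1 + c * w 1 ^ 2) := by
  simp only [hP, Pi.add_apply, Pi.smul_apply, smul_eq_mul]
  ring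

/-- A connected set which meets the interior of a regular closed set `D` and misses its frontier
lies in the interior of `D`. [folklore] -/
theorem subset_interior_of_isPreconnected {C : Set (Fin 2 → ℝ)} (hD : IsClosed D)
    (hreg : closure (interior D) = D) (hC : IsPreconnected C) (hne : (C ∩ interior D).Nonempty)
    (hfr : ∀ x ∈ C, x ∉ frontier D) : C ⊆ interior D :=
  hC.subset_of_closure_inter_subset isOpen_interior hne (by
    rw [hreg]
    rintro x ⟨hxD, hxC⟩
    by_contra h
    exact hfr x hxC (by rw [hD.frontier_eq]; exact ⟨hxD, h⟩))

/-- No ray issued from an interior point of a compact regular closed set `D` misses the frontier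
of `D` (the ray is connected and unbounded). [folklore] -/
theorem false_of_ray (hK : IsCompact D) (hreg : closure (interior D) = D) {x w : Fin 2 → ℝ}
    (hx : x ∈ interior D) (hw : w ≠ 0) (hray : ∀ t : ℝ, 0 ≤ t → x + t • w ∉ frontier D) :
    False := by
  have hsub : (fun t : ℝ => x + t • w) '' Ici 0 ⊆ interior D :=
    subset_interior_of_isPreconnected hK.isClosed hreg
      (isPreconnected_Ici.image _ (by fun_prop : Continuous fun t : ℝ => x + t • w).continuousOn)
      ⟨x, ⟨0, self_mem_Ici, by simp⟩, hx⟩ (by rintro _ ⟨t, ht, rfl⟩; exact hray t ht)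
  obtain ⟨R, hR⟩ := isBounded_iff_forall_norm_le.mp hK.isBounded
  have hw' : 0 < ‖w‖ := norm_pos_iff.mpr hw
  have hxR : ‖x‖ ≤ R := hR x (interior_subset hx)
  have ht0 : 0 ≤ (R + ‖x‖ + 1) / ‖w‖ := div_nonneg (by linarith [norm_nonneg x]) hw'.le
  have h1 := hR _ (interior_subset (hsub ⟨(R + ‖x‖ + 1) / ‖w‖, ht0, rfl⟩))
  have h2 := norm_sub_le (x + ((R + ‖x‖ + 1) / ‖w‖) • w) x
  rw [add_sub_cancel_left, norm_smul, Real.norm_of_nonneg ht0, div_mul_cancel₀ _ hw'.ne'] at h2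
  linarith

/-- If a quadratic function vanishes on an open set, so does its gradient (difference quotients
along the two axes). [folklore] -/
theorem grad_eq_zero
    (hP : ∀ x, P x = a * x 0 ^ 2 + b * x 0 * x 1 + c * x 1 ^ 2 + d * x 0 + e * x 1 + f)
    {U : Set (Fin 2 → ℝ)} (hU : IsOpen U) (h0 : ∀ x ∈ U, P x = 0) {y : Fin 2 → ℝ} (hy : y ∈ U) :
    2 * a * y 0 + b * y 1 + d = 0 ∧ b * y 0 + 2 * c * y 1 + e = 0 := by
  have step : ∀ w : Fin 2 → ℝ, ∃ s : ℝ, s ≠ 0 ∧ P (y + s • w) = 0 ∧ P (y + (-s) • w) = 0 := by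
    intro w
    have ho : IsOpen {s : ℝ | y + s • w ∈ U} := hU.preimage (by fun_prop)
    obtain ⟨ε, hε, hb⟩ := Metric.isOpen_iff.mp ho 0 (by simpa using hy)
    rw [Real.ball_eq_Ioo, zero_sub, zero_add] at hb
    exact ⟨ε / 2, by positivity, h0 _ (hb ⟨by linarith, by linarith⟩),
      h0 _ (hb ⟨by linarith, by linarith⟩)⟩
  obtain ⟨s, hs, h1, h2⟩ := step ![1, 0]
  obtain ⟨s', hs', h3, h4⟩ := step ![0, 1]
  rw [taylor_two hP] at h1 h2 h3 h4
  simp only [Matrix.cons_val_zero, Matrix.cons_val_one] at h1 h2 h3 h4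
  constructor
  · have h : 2 * s * (2 * a * y 0 + b * y 1 + d) = 0 := by linear_combination h1 - h2
    simpa [hs] using h
  · have h : 2 * s' * (b * y 0 + 2 * c * y 1 + e) = 0 := by linear_combination h3 - h4
    simpa [hs'] using h

/-- **Escape along a ray.** If `P x ≠ 0` at an interior point `x` of a compact regular closed set
`D` whose frontier lies in `{P = 0}`, then the quadratic part `Q` of `P` takes the sign opposite
to `P x` at every `w ≠ 0`: otherwise, orienting `w` so that `∇P(x)·w` has the sign of `P x`,
`|P| ≥ |P x| > 0` along the ray `x + ℝ₊ w`, which then misses the frontier. [folklore] -/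
theorem no_escape
    (hP : ∀ x, P x = a * x 0 ^ 2 + b * x 0 * x 1 + c * x 1 ^ 2 + d * x 0 + e * x 1 + f)
    (hK : IsCompact D) (hreg : closure (interior D) = D) (hfr : ∀ x ∈ frontier D, P x = 0)
    {x v : Fin 2 → ℝ} (hx : x ∈ interior D) (hPx : P x ≠ 0) (hv : v ≠ 0)
    (hs : 0 ≤ P x * (a * v 0 ^ 2 + b * v 0 * v 1 + c * v 1 ^ 2)) : False := by
  obtain ⟨w, hw, hsw, hLw⟩ : ∃ w : Fin 2 → ℝ, w ≠ 0 ∧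
      0 ≤ P x * (a * w 0 ^ 2 + b * w 0 * w 1 + c * w 1 ^ 2) ∧
      0 ≤ P x * ((2 * a * x 0 + b * x 1 + d) * w 0 + (b * x 0 + 2 * c * x 1 + e) * w 1) := by
    rcases le_total 0
      (P x * ((2 * a * x 0 + b * x 1 + d) * v 0 + (b * x 0 + 2 * c * x 1 + e) * v 1)) with h | h
    · exact ⟨v, hv, hs, h⟩
    · refine ⟨-v, neg_ne_zero.mpr hv, ?_, ?_⟩ <;> simp only [Pi.neg_apply] <;> nlinarith [hs, h]
  refine false_of_ray hK hreg hx hw fun t ht hmem => ?_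
  have h0 := hfr _ hmem
  rw [taylor_two hP] at h0
  have hx2 : 0 < P x ^ 2 := by positivity
  nlinarith [mul_nonneg ht hLw, mul_nonneg (sq_nonneg t) hsw, congrArg (fun y => P x * y) h0]

/-- **Classification of smooth conic stones** (one orientation). If the frontier of a compact
regular closed set `D` with non-empty interior lies in the smooth locus of a quadratic function `P`
whose quadratic part `Q` is not negative definite, then `Q` is positive definite, `P < 0`
somewhere and `D = {P ≤ 0}` is the filled ellipse. [folklore] -/
theorem classify_half
    (hP : ∀ x, P x = a * x 0 ^ 2 + b * x 0 * x 1 + c * x 1 ^ 2 + d * x 0 + e * x 1 + f)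
    (hK : IsCompact D) (hreg : closure (interior D) = D) (hne : (interior D).Nonempty)
    (hfr : frontier D ⊆
      {x | P x = 0 ∧ (2 * a * x 0 + b * x 1 + d ≠ 0 ∨ b * x 0 + 2 * c * x 1 + e ≠ 0)})
    (hQ : ∃ v : Fin 2 → ℝ, v ≠ 0 ∧ 0 ≤ a * v 0 ^ 2 + b * v 0 * v 1 + c * v 1 ^ 2) :
    0 < a ∧ 0 < 4 * a * c - b ^ 2 ∧ (∃ x, P x < 0) ∧ D = {x | P x ≤ 0} := by
  have hfr0 : ∀ x ∈ frontier D, P x = 0 := fun x hx => (hfr hx).1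
  -- (i) `P` does not vanish identically on the interior
  obtain ⟨x₀, hx₀, hP₀⟩ : ∃ x ∈ interior D, P x ≠ 0 := by
    by_contra! h
    obtain ⟨z, hz⟩ : (frontier D).Nonempty :=
      nonempty_frontier_iff.mpr ⟨hne.mono interior_subset, hK.ne_univ⟩
    have hcl : closure (interior D) ⊆
        {x | 2 * a * x 0 + b * x 1 + d = 0} ∩ {x | b * x 0 + 2 * c * x 1 + e = 0} :=
      closure_minimal (fun y hy => grad_eq_zero hP isOpen_interior h hy)
        ((isClosed_eq (by fun_prop) (by fun_prop)).inter (isClosed_eq (by fun_prop) (by fun_prop)))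
    obtain ⟨h1, h2⟩ := hcl (hreg.symm ▸ hK.isClosed.frontier_subset hz)
    rcases (hfr hz).2 with h | h
    · exact h h1
    · exact h h2
  -- (ii) no interior point has `P > 0`, hence the quadratic part is positive definite
  have hle : ∀ x ∈ interior D, P x ≤ 0 := fun x hx => by
    by_contra! hpos
    obtain ⟨v, hv, hQv⟩ := hQ
    exact no_escape hP hK hreg hfr0 hx hpos.ne' hv (mul_nonneg hpos.le hQv)
  have hneg : P x₀ < 0 := (hle x₀ hx₀).lt_of_ne hP₀
  have hpd : ∀ v : Fin 2 → ℝ, v ≠ 0 → 0 < a * v 0 ^ 2 + b * v 0 * v 1 + c * v 1 ^ 2 := fun v hv => by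
    by_contra! hQv
    exact no_escape hP hK hreg hfr0 hx₀ hneg.ne hv (mul_nonneg_of_nonpos_of_nonpos hneg.le hQv)
  have ha : 0 < a := by simpa using hpd ![1, 0] (fun h => by simpa using congr_fun h 0)
  have hm : 0 < 4 * a * c - b ^ 2 := by
    have h := hpd ![-b, 2 * a] (fun h => ha.ne' (by simpa using congr_fun h 1))
    simp only [Matrix.cons_val_zero, Matrix.cons_val_one] at h
    exact (mul_pos_iff_of_pos_left ha).mp (by linarith [h])
  have hPc : Continuous P := by rw [show P = _ from funext hP]; fun_prop
  -- (iii) convexity of `P`: `{P < 0}` is convex, meets the interior at `x₀`, misses the frontier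
  have hQnn : ∀ u₀ u₁ : ℝ, 0 ≤ a * u₀ ^ 2 + b * u₀ * u₁ + c * u₁ ^ 2 := fun u₀ u₁ => by
    have h : 0 ≤ (2 * a * u₀ + b * u₁) ^ 2 + (4 * a * c - b ^ 2) * u₁ ^ 2 := by positivity
    nlinarith [h]
  have hconv : ∀ x y : Fin 2 → ℝ, ∀ s : ℝ, 0 ≤ s → s ≤ 1 →
      P (s • x + (1 - s) • y) ≤ s * P x + (1 - s) * P y := fun x y s hs hs1 => by
    have key : P (s • x + (1 - s) • y) = s * P x + (1 - s) * P y -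
        s * (1 - s) * (a * (x 0 - y 0) ^ 2 + b * (x 0 - y 0) * (x 1 - y 1) + c * (x 1 - y 1) ^ 2) := by
      simp only [hP, Pi.add_apply, Pi.smul_apply, smul_eq_mul]
      ring
    rw [key]
    nlinarith [hQnn (x 0 - y 0) (x 1 - y 1), mul_nonneg hs (sub_nonneg.mpr hs1)]
  have hN : {x | P x < 0} ⊆ interior D := by
    refine subset_interior_of_isPreconnected hK.isClosed hreg (Convex.isPreconnected ?_)
      ⟨x₀, hneg, hx₀⟩ (fun x hx hxf => by simp [hfr0 x hxf] at hx)
    intro x hx y hy s t hs ht hst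
    obtain rfl : t = 1 - s := by linarith
    have hM : s * P x + (1 - s) * P y ≤ max (P x) (P y) := by
      nlinarith [mul_le_mul_of_nonneg_left (le_max_left (P x) (P y)) hs,
        mul_le_mul_of_nonneg_left (le_max_right (P x) (P y)) ht]
    exact (hconv x y s hs (by linarith)).trans_lt (hM.trans_lt (max_lt hx hy))
  refine ⟨ha, hm, ⟨x₀, hneg⟩, Subset.antisymm ?_ fun y (hy : P y ≤ 0) => ?_⟩
  · rw [← hreg]
    exact closure_minimal hle (isClosed_le hPc continuous_const)
  · -- `y` is the limit of the points `s x₀ + (1 - s) y ∈ {P < 0} ⊆ D`, `s → 0⁺`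
    refine (hK.isClosed.closure_eq ▸ closure_mono (hN.trans interior_subset))
      (mem_closure_of_tendsto (f := fun s : ℝ => s • x₀ + (1 - s) • y) (b := 𝓝[>] 0)
      (((by fun_prop : Continuous fun s : ℝ => s • x₀ + (1 - s) • y).tendsto' 0 y
        (by simp)).mono_left nhdsWithin_le_nhds) ?_)
    filter_upwards [Ioo_mem_nhdsGT (zero_lt_one' ℝ)] with s hs
    have h := hconv x₀ y s hs.1.le hs.2.le
    show P (s • x₀ + (1 - s) • y) < 0
    nlinarith [mul_neg_of_pos_of_neg hs.1 hneg, mul_nonpos_iff.mpr (Or.inl ⟨sub_nonneg.mpr hs.2.le, hy⟩)]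

end Real

/-- **Completing squares.** For rationals `a > 0`, `4ac − b² > 0` and `P = a x₀² + b x₀x₁ + c x₁² +
d x₀ + e x₁ + f` negative somewhere, the filled ellipse `{P ≤ 0}` is the image of the closed unit
disc under `y ↦ A y + c₀` with `c₀` the (rational) centre and
`A = !![√(k/a), −(b/2a)·√(k/γ); 0, √(k/γ)]`, `γ = (4ac − b²)/4a`, `k = −P(c₀) > 0`: real-algebraic
entries, `det A ≠ 0`. [folklore] -/
theorem ellipse_eq_image {a b c d e f : ℚ} {P : (Fin 2 → ℝ) → ℝ}
    (hP : ∀ x, P x = a * x 0 ^ 2 + b * x 0 * x 1 + c * x 1 ^ 2 + d * x 0 + e * x 1 + f)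
    (ha : 0 < a) (hm : 0 < 4 * a * c - b ^ 2) (hneg : ∃ x, P x < 0) :
    ∃ (A : Matrix (Fin 2) (Fin 2) ℝ) (v : Fin 2 → ℝ), (∀ i j, IsAlgebraic ℚ (A i j)) ∧
      (∀ i, IsAlgebraic ℚ (v i)) ∧ A.det ≠ 0 ∧
      {x | P x ≤ 0} = (fun y => A.mulVec y + v) '' {y | ∑ i, y i ^ 2 ≤ 1} := by
  obtain ⟨m, hmd⟩ : ∃ q : ℚ, q = 4 * a * c - b ^ 2 := ⟨_, rfl⟩
  have hm0 : m ≠ 0 := by rw [hmd]; exact hm.ne'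
  have hmp : 0 < m := by rw [hmd]; exact hm
  have ha0 : a ≠ 0 := ha.ne'
  obtain ⟨β, hβ⟩ : ∃ q : ℚ, q = b / (2 * a) := ⟨_, rfl⟩
  obtain ⟨γ, hγ⟩ : ∃ q : ℚ, q = m / (4 * a) := ⟨_, rfl⟩
  obtain ⟨c₀, hc₀⟩ : ∃ q : ℚ, q = (b * e - 2 * c * d) / m := ⟨_, rfl⟩
  obtain ⟨c₁, hc₁⟩ : ∃ q : ℚ, q = (b * d - 2 * a * e) / m := ⟨_, rfl⟩
  obtain ⟨k, hk⟩ : ∃ q : ℚ, q = -(a * c₀ ^ 2 + b * c₀ * c₁ + c * c₁ ^ 2 + d * c₀ + e * c₁ + f) :=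
    ⟨_, rfl⟩
  have hγ0 : 0 < γ := by rw [hγ]; positivity
  -- the centre `(c₀, c₁)` kills the linear part; `β`, `γ` diagonalise the quadratic part
  have R1 : 2 * a * β = b := by rw [hβ]; field_simp
  have R2 : a * β ^ 2 + γ = c := by rw [hβ, hγ]; field_simp; rw [hmd]; ring
  have R3 : 2 * a * c₀ + b * c₁ + d = 0 := by rw [hc₀, hc₁]; field_simp; rw [hmd]; ring
  have R4 : b * c₀ + 2 * c * c₁ + e = 0 := by rw [hc₀, hc₁]; field_simp; rw [hmd]; ring
  -- the square-root-free identity `P (u + c₀) = a (u₀ + β u₁)² + γ u₁² − k`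
  have I1 : ∀ u₀ u₁ : ℝ, (a : ℝ) * (u₀ + c₀) ^ 2 + b * (u₀ + c₀) * (u₁ + c₁) + c * (u₁ + c₁) ^ 2 +
      d * (u₀ + c₀) + e * (u₁ + c₁) + f = a * (u₀ + β * u₁) ^ 2 + γ * u₁ ^ 2 - k := by
    intro u₀ u₁
    have R1' : (2 * a * β : ℝ) = b := by exact_mod_cast R1
    have R2' : (a * β ^ 2 + γ : ℝ) = c := by exact_mod_cast R2
    have R3' : (2 * a * c₀ + b * c₁ + d : ℝ) = 0 := by exact_mod_cast R3
    have R4' : (b * c₀ + 2 * c * c₁ + e : ℝ) = 0 := by exact_mod_cast R4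
    have R5' : (k : ℝ) = -(a * c₀ ^ 2 + b * c₀ * c₁ + c * c₁ ^ 2 + d * c₀ + e * c₁ + f) := by
      rw [hk]; push_cast; ring
    linear_combination u₀ * R3' + u₁ * R4' - (u₀ * u₁) * R1' - u₁ ^ 2 * R2' + R5'
  have hk0 : 0 < k := by
    obtain ⟨x, hx⟩ := hneg
    have h := I1 (x 0 - c₀) (x 1 - c₁)
    rw [sub_add_cancel, sub_add_cancel, ← hP] at h
    have h1 : (0 : ℝ) ≤ a * (x 0 - c₀ + β * (x 1 - c₁)) ^ 2 := by positivity
    have h2 : (0 : ℝ) ≤ γ * (x 1 - c₁) ^ 2 := by positivity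
    exact_mod_cast (show (0 : ℝ) < k by linarith)
  have hk' : (0 : ℝ) < k := by exact_mod_cast hk0
  -- the two square roots and the matrix
  have n1 : (0 : ℝ) ≤ ((k / a : ℚ) : ℝ) := by positivity
  have n2 : (0 : ℝ) ≤ ((k / γ : ℚ) : ℝ) := by positivity
  set s₁ : ℝ := Real.sqrt ((k / a : ℚ) : ℝ) with hs₁
  set s₂ : ℝ := Real.sqrt ((k / γ : ℚ) : ℝ) with hs₂
  have e1 : (a : ℝ) * s₁ ^ 2 = k := by rw [hs₁, Real.sq_sqrt n1]; push_cast; field_simp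
  have e2 : (γ : ℝ) * s₂ ^ 2 = k := by rw [hs₂, Real.sq_sqrt n2]; push_cast; field_simp [hγ0.ne']
  have hs1 : 0 < s₁ := Real.sqrt_pos.mpr (by positivity)
  have hs2 : 0 < s₂ := Real.sqrt_pos.mpr (by positivity)
  set A : Matrix (Fin 2) (Fin 2) ℝ := !![s₁, -(β * s₂); 0, s₂] with hA
  have hdet : A.det ≠ 0 := by rw [hA, Matrix.det_fin_two_of]; simp [hs1.ne', hs2.ne']
  -- the forward identity `P (A y + c₀) = k |y|² − k`
  have fwd : ∀ y : Fin 2 → ℝ, P (A.mulVec y + ![(c₀ : ℝ), c₁]) = k * (y 0 ^ 2 + y 1 ^ 2) - k := by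
    intro y
    have h0 : (A.mulVec y + ![(c₀ : ℝ), c₁]) 0 = (s₁ * y 0 - β * s₂ * y 1) + c₀ := by
      simp [hA, dotProduct, Fin.sum_univ_two]; ring
    have h1 : (A.mulVec y + ![(c₀ : ℝ), c₁]) 1 = s₂ * y 1 + c₁ := by
      simp [hA, dotProduct, Fin.sum_univ_two]
    rw [hP, h0, h1]
    linear_combination I1 (s₁ * y 0 - β * s₂ * y 1) (s₂ * y 1) + (y 0 ^ 2) * e1 + (y 1 ^ 2) * e2
  refine ⟨A, ![(c₀ : ℝ), c₁], fun i j => ?_, fun i => ?_, hdet, ?_⟩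
  · have alg1 : IsAlgebraic ℚ s₁ := redAux_isAlgebraic_sqrt (isAlgebraic_rat ℚ _) n1
    have alg2 : IsAlgebraic ℚ s₂ := redAux_isAlgebraic_sqrt (isAlgebraic_rat ℚ _) n2
    rw [hA]
    fin_cases i <;> fin_cases j
    exacts [alg1, ((isAlgebraic_rat ℚ β).mul alg2).neg, isAlgebraic_zero, alg2]
  · fin_cases i <;> exact isAlgebraic_rat ℚ _
  · ext x
    constructor
    · intro (hx : P x ≤ 0)
      obtain ⟨y, rfl⟩ := InverseLandau.AffineEngine.affine_surjective ![(c₀ : ℝ), c₁] hdet x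
      refine ⟨y, ?_, rfl⟩
      have h := fwd y
      show ∑ i, y i ^ 2 ≤ 1
      rw [Fin.sum_univ_two]
      nlinarith
    · rintro ⟨y, hy, rfl⟩
      show P _ ≤ 0
      have hy' : y 0 ^ 2 + y 1 ^ 2 ≤ 1 := by simpa [Fin.sum_univ_two] using hy
      rw [fwd y]
      nlinarith

/-- **A smooth conic stone is a real-algebraic affine image of the closed unit disc**: a compact
regular closed planar set with non-empty interior whose frontier lies in the smooth real locus of
a rational polynomial `p` of total degree `≤ 2` is `A·B̄ + c₀` with `A`, `c₀` real algebraic and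
`det A ≠ 0` (`classify_half` for `σ·p`, `σ = ±1` the sign of the `x₀²`-coefficient, then
`ellipse_eq_image`). [folklore] -/
theorem stone_eq_image (D : Set (Fin 2 → ℝ)) (hK : IsCompact D)
    (hreg : closure (interior D) = D) (hne : (interior D).Nonempty) (p : MvPolynomial (Fin 2) ℚ)
    (hp : p.totalDegree ≤ 2) (hfr : frontier D ⊆
      {x | MvPolynomial.aeval x p = 0 ∧ ∃ i, MvPolynomial.aeval x (MvPolynomial.pderiv i p) ≠ 0}) :
    ∃ (A : Matrix (Fin 2) (Fin 2) ℝ) (v : Fin 2 → ℝ), (∀ i j, IsAlgebraic ℚ (A i j)) ∧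
      (∀ i, IsAlgebraic ℚ (v i)) ∧ A.det ≠ 0 ∧
      D = (fun y => A.mulVec y + v) '' {y | ∑ i, y i ^ 2 ≤ 1} := by
  obtain ⟨a, b, c, d, e, f, h⟩ := exists_coeffs p hp
  -- the sign `σ = ±1` making the quadratic part of `σ p` not negative definite (test `e₀`)
  obtain ⟨σ, hσ, hσa⟩ : ∃ σ : ℚ, (σ = 1 ∨ σ = -1) ∧ 0 ≤ σ * a := by
    rcases le_total 0 a with ha | ha
    · exact ⟨1, Or.inl rfl, by simpa using ha⟩
    · exact ⟨-1, Or.inr rfl, by simpa using ha⟩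
  have hσ0 : (σ : ℝ) ≠ 0 := by rcases hσ with rfl | rfl <;> norm_num
  have hP : ∀ x, (fun x => (σ : ℝ) * MvPolynomial.aeval x p) x = ((σ * a : ℚ) : ℝ) * x 0 ^ 2 +
      ((σ * b : ℚ) : ℝ) * x 0 * x 1 + ((σ * c : ℚ) : ℝ) * x 1 ^ 2 + ((σ * d : ℚ) : ℝ) * x 0 +
      ((σ * e : ℚ) : ℝ) * x 1 + ((σ * f : ℚ) : ℝ) := fun x => by
    simp only [(h x).1]
    push_cast
    ring
  have hfr' : frontier D ⊆ {x | (fun x => (σ : ℝ) * MvPolynomial.aeval x p) x = 0 ∧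
      (2 * ((σ * a : ℚ) : ℝ) * x 0 + ((σ * b : ℚ) : ℝ) * x 1 + ((σ * d : ℚ) : ℝ) ≠ 0 ∨
        ((σ * b : ℚ) : ℝ) * x 0 + 2 * ((σ * c : ℚ) : ℝ) * x 1 + ((σ * e : ℚ) : ℝ) ≠ 0)} := by
    intro x hx
    obtain ⟨h0, hi⟩ := hfr hx
    refine ⟨by simp only [h0, mul_zero], ?_⟩
    push_cast
    rcases Fin.exists_fin_two.mp hi with hi | hi
    · refine Or.inl fun h2 => hi ?_
      rw [(h x).2.1]
      exact (mul_eq_zero.mp (show (σ : ℝ) * (2 * a * x 0 + b * x 1 + d) = 0 by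
        linear_combination h2)).resolve_left hσ0
    · refine Or.inr fun h2 => hi ?_
      rw [(h x).2.2]
      exact (mul_eq_zero.mp (show (σ : ℝ) * (b * x 0 + 2 * c * x 1 + e) = 0 by
        linear_combination h2)).resolve_left hσ0
  have hQ : ∃ v : Fin 2 → ℝ, v ≠ 0 ∧ 0 ≤ ((σ * a : ℚ) : ℝ) * v 0 ^ 2 +
      ((σ * b : ℚ) : ℝ) * v 0 * v 1 + ((σ * c : ℚ) : ℝ) * v 1 ^ 2 :=
    ⟨![1, 0], fun h => by simpa using congr_fun h 0, by simpa using (by exact_mod_cast hσa :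
      (0 : ℝ) ≤ ((σ * a : ℚ) : ℝ))⟩
  obtain ⟨ha, hm, hneg, hD⟩ := classify_half hP hK hreg hne hfr' hQ
  obtain ⟨A, v, hA, hv, hdet, himg⟩ :=
    ellipse_eq_image hP (by exact_mod_cast ha) (by exact_mod_cast hm) hneg
  exact ⟨A, v, hA, hv, hdet, hD.trans himg⟩

/-- **`ConicStones`** (route WeightFloor, stmt-KontsevichZagierPeriods-12251): two integrand-`1`
representations over smooth conic stones (compact regular closed planar sets with non-empty
interior whose frontier lies in the smooth real locus of a rational polynomial of total degree
`≤ 2`) with the same value are KZ-equivalent. Proof: both stones are real-algebraic affine images of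
the closed unit disc (`stone_eq_image`), and two such ellipsoids with the same volume are
KZ-equivalent by the landed ellipsoid sector `InverseLandau.kzPeriodConjecture_ellipsoid`.
[cite: KontsevichZagier2001, §1.2] -/
theorem conicStones_proof :
    Summit.KontsevichZagierPeriods.KontsevichZagierPeriods.Theses.WeightFloor.ConicStones := by
  intro r r' hr hr' ⟨hK, hreg, hne, p, hp, hfr⟩ ⟨hK', hreg', hne', p', hp', hfr'⟩ hv
  obtain ⟨A, b, hA, hb, hdet, hdom⟩ := stone_eq_image r.domain hK hreg hne p hp hfr
  obtain ⟨A', b', hA', hb', hdet', hdom'⟩ := stone_eq_image r'.domain hK' hreg' hne' p' hp' hfr'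
  exact InverseLandau.kzPeriodConjecture_ellipsoid A b A' b' r r' hA hb hdet hdom hr hA' hb' hdet'
    hdom' hr' hv

end Summit.KontsevichZagierPeriods.WeightFloor
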